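import Literature.Topology.FourManifolds.SimplifiedBrokenLefschetzSidesGenus
import Literature.Topology.FourManifolds.SimplifiedBrokenLefschetzRoundSlicesIndex
import Literature.Topology.FourManifolds.SimplifiedBrokenLefschetzHeight
import Literature.Topology.FourManifolds.SphereHeightFoldCurves
import HarnessLib

/-!
# The base function `y₀ (1 - ⟪y, v⟫/4)` on the round 2-sphere, I: Lagrange calculus
# — helper `helper_basePoint` for stub `stub_baseFunction` of line `Sketch`,
# crux `SblfDescent.RungOne`

(Crux item stmt-SmoothPoincare4-18531; skeleton `Cruxes/RungOne/Lines/Sketch.lean`.)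

The line `Sketch` builds a six-critical-point Morse function on a homotopy 4-sphere carrying a
genus-one simplified broken Lefschetz fibration `f : X → S²` by composing `f` with the **base
function** `ℓ(y) = y₀ (1 + κ ⟪y, v⟫)`, `κ = -1/4`, `v = (0, 0, ±1)`, on the round sphere
`S² ⊆ ℝ³`.  This file is the calculus of `ℓ` (Milnor 1963, §2, Lagrange multipliers on the
level hypersurface `S² = {‖x‖² = 1}`), read directly in Mathlib's manifold structure on
`Metric.sphere`:

* `isMCriticalPt_sphere_iff` — a restricted ambient function `G|S²` is critical at `y` iff
  `DG(y)` kills `yᗮ = T_y S²` (`range_mfderiv_coe_sphere`);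
* `mhessian_sphere_apply_self` — at such a point, with `DG(y) = ν ⟪y, ·⟫`, the Hessian of
  `G|S²` (the tree's `mhessian`, preferred chart) on the diagonal is `D²G(y)(w, w) - ν ‖w‖²`
  for a nonzero tangent vector `w` (second-order chain rule through the chart, the sphere
  constraint differentiated twice);
* the two derivatives of the base polynomial, Lagrange's condition in coordinates
  (`isMCriticalPt_base_iff`), and the registered helper `helper_basePoint` — the points
  `(ε r, 0, s v₂)`, `ε = ±1`, `s = 1 - √(3/2)` (the root of `s² - 2s - 1/2` in `[-1, 1]`),
  `r = √(1 - s²)`, are critical, with `ε`-definite Hessian and value `ε r (1 - s/4)`.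

Part II (`SblfDescentRungOneStubBaseFunction.lean`) classifies the critical points and
assembles the stub.  Everything is proved; no definitions, no named facts, no local notation
(the sphere is `Metric.sphere (0 : EuclideanSpace ℝ (Fin 3)) 1` with Mathlib's instances; the
`Fact (finrank = 2 + 1)` needed by Mathlib's sphere lemmas is supplied inside the proofs).

## References

* J. Milnor, *Morse theory*, Ann. of Math. Studies 51 (1963), §2. [Milnor1963]
* R. İ. Baykur, *Broken Lefschetz fibrations and smooth structures on 4-manifolds*, Geom.
  Topol. Monogr. 18 (2012), Lemma 7 (the Morse function `ℓ ∘ f`). [Baykur2012]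
-/

-- the prescribed namespace `Summit.<P>.<Sub>.…` duplicates `SmoothPoincare4` (P = Sub)
set_option linter.dupNamespace false

noncomputable section

open scoped Manifold ContDiff Topology RealInnerProductSpace
open Set Function Literature.Topology.FourManifolds Literature.AlgebraicTopology.SingularHomology

namespace Summit.SmoothPoincare4.SmoothPoincare4.Cruxes.RungOne.Sketch

/-! ### Lagrange calculus on Mathlib's round sphere -/

/-- **Critical points of a restricted ambient function on `S²`** (Lagrange): for `G`
differentiable at `y ∈ S²`, `y` is a critical point of `G|S²` iff `DG(y)` vanishes on the
tangent plane `T_y S² = yᗮ` (`range_mfderiv_coe_sphere`). [cite: Milnor1963, §2] -/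
theorem isMCriticalPt_sphere_iff {G : EuclideanSpace ℝ (Fin 3) → ℝ} (y : (Metric.sphere (0 : EuclideanSpace ℝ (Fin 3)) 1)) (hG : DifferentiableAt ℝ G y) :
    IsMCriticalPt (𝓡 2) (fun z : (Metric.sphere (0 : EuclideanSpace ℝ (Fin 3)) 1) => G z) y ↔
      ∀ w : EuclideanSpace ℝ (Fin 3), ⟪(y : EuclideanSpace ℝ (Fin 3)), w⟫ = 0 → fderiv ℝ G y w = 0 := by
  haveI : Fact (Module.finrank ℝ (EuclideanSpace ℝ (Fin 3)) = 2 + 1) := ⟨finrank_euclideanSpace_fin⟩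
  set L : EuclideanSpace ℝ (Fin 2) →L[ℝ] EuclideanSpace ℝ (Fin 3) :=
    mfderiv (𝓡 2) 𝓘(ℝ, EuclideanSpace ℝ (Fin 3)) (Subtype.val : (Metric.sphere (0 : EuclideanSpace ℝ (Fin 3)) 1) → EuclideanSpace ℝ (Fin 3)) y with hL
  have hval : HasMFDerivAt (𝓡 2) 𝓘(ℝ, EuclideanSpace ℝ (Fin 3)) (Subtype.val : (Metric.sphere (0 : EuclideanSpace ℝ (Fin 3)) 1) → EuclideanSpace ℝ (Fin 3)) y L :=
    ((contMDiff_coe_sphere (m := 1) y).mdifferentiableAt one_ne_zero).hasMFDerivAt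
  have hcomp : HasMFDerivAt (𝓡 2) 𝓘(ℝ, ℝ) (fun z : (Metric.sphere (0 : EuclideanSpace ℝ (Fin 3)) 1) => G z) y ((fderiv ℝ G y).comp L) :=
    hG.hasFDerivAt.hasMFDerivAt.comp y hval
  have hrange : L.range = (ℝ ∙ (y : EuclideanSpace ℝ (Fin 3)))ᗮ := range_mfderiv_coe_sphere y
  rw [IsMCriticalPt, hcomp.mfderiv]
  constructor
  · intro h w hw
    have hw' : w ∈ (ℝ ∙ (y : EuclideanSpace ℝ (Fin 3)))ᗮ := Submodule.mem_orthogonal_singleton_iff_inner_right.2 hw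
    rw [← hrange, LinearMap.mem_range] at hw'
    obtain ⟨a, rfl⟩ := hw'
    exact DFunLike.congr_fun h a
  · intro h
    ext a
    have ha : L a ∈ (ℝ ∙ (y : EuclideanSpace ℝ (Fin 3)))ᗮ := by rw [← hrange]; exact ⟨a, rfl⟩
    exact h (L a) (Submodule.mem_orthogonal_singleton_iff_inner_right.1 ha)

/-- A vector `g` is orthogonal to the tangent plane `yᗮ` of the unit sphere at `y` iff it is
a multiple of `y` (`yᗮᗮ = ℝ y`, written out). [folklore] -/
theorem forall_inner_eq_zero_iff (y g : EuclideanSpace ℝ (Fin 3)) (hy : ‖y‖ = 1) :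
    (∀ w : EuclideanSpace ℝ (Fin 3), ⟪y, w⟫ = 0 → ⟪g, w⟫ = 0) ↔ ∃ ν : ℝ, g = ν • y := by
  have hyy : ⟪y, y⟫ = 1 := by rw [real_inner_self_eq_norm_sq, hy, one_pow]
  constructor
  · intro h
    refine ⟨⟪g, y⟫, ?_⟩
    set w := g - ⟪g, y⟫ • y with hw
    have h1 : ⟪y, w⟫ = 0 := by
      show ⟪y, g - ⟪g, y⟫ • y⟫ = 0
      rw [inner_sub_right, real_inner_smul_right, hyy, mul_one, real_inner_comm, sub_self]
    have h3 : ⟪w, w⟫ = 0 := by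
      have : ⟪w, w⟫ = ⟪g, w⟫ - ⟪g, y⟫ * ⟪y, w⟫ := by
        show ⟪g - ⟪g, y⟫ • y, w⟫ = _
        rw [inner_sub_left, real_inner_smul_left]
      rw [this, h w h1, h1, mul_zero, sub_zero]
    have h4 : g - ⟪g, y⟫ • y = 0 := inner_self_eq_zero.1 h3
    exact sub_eq_zero.1 h4
  · rintro ⟨ν, h⟩ w hw
    rw [h, real_inner_smul_left, hw, mul_zero]

/-- **The Hessian of a restricted ambient function at a Lagrange point of `S²`.**  If `G` is
`C²` at `y ∈ S²` with `DG(y) = ν ⟪y, ·⟫` (so `y` is critical for `G|S²`, multiplier `ν`), then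
for every nonzero model vector `a` there is a nonzero tangent vector `w ⊥ y` (namely
`w = d(incl)_y a`) with `Hess(G|S²)_y(a, a) = D²G(y)(w, w) - ν ‖w‖²`: in the preferred chart
`τ = incl ∘ chart⁻¹`, `D²(G ∘ τ)(a, a) = D²G(Dτ a, Dτ a) + DG(D²τ(a, a))` and differentiating
`‖τ‖² = 1` twice gives `⟪y, D²τ(a, a)⟫ = -‖Dτ a‖²` (Milnor 1963, §2). [cite: Milnor1963, §2] -/
theorem mhessian_sphere_apply_self {G : EuclideanSpace ℝ (Fin 3) → ℝ} (y : (Metric.sphere (0 : EuclideanSpace ℝ (Fin 3)) 1)) (hG : ContDiffAt ℝ 2 G y) {ν : ℝ}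
    (hlag : ∀ w : EuclideanSpace ℝ (Fin 3), fderiv ℝ G y w = ν * ⟪(y : EuclideanSpace ℝ (Fin 3)), w⟫) {a : EuclideanSpace ℝ (Fin 2)} (ha : a ≠ 0) :
    ∃ w : EuclideanSpace ℝ (Fin 3), w ≠ 0 ∧ ⟪(y : EuclideanSpace ℝ (Fin 3)), w⟫ = 0 ∧
      mhessian (𝓡 2) (fun z : (Metric.sphere (0 : EuclideanSpace ℝ (Fin 3)) 1) => G z) y a a =
        fderiv ℝ (fderiv ℝ G) y w w - ν * ⟪w, w⟫ := by
  haveI : Fact (Module.finrank ℝ (EuclideanSpace ℝ (Fin 3)) = 2 + 1) := ⟨finrank_euclideanSpace_fin⟩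
  haveI : IsManifold (𝓡 2) 2 (Metric.sphere (0 : EuclideanSpace ℝ (Fin 3)) 1) :=
    IsManifold.of_le (n := ∞) (by norm_cast)
  have hval : ContMDiffAt (𝓡 2) 𝓘(ℝ, EuclideanSpace ℝ (Fin 3)) 2 (Subtype.val : (Metric.sphere (0 : EuclideanSpace ℝ (Fin 3)) 1) → EuclideanSpace ℝ (Fin 3)) y :=
    contMDiff_coe_sphere (m := 2) y
  have hvald : MDifferentiableAt (𝓡 2) 𝓘(ℝ, EuclideanSpace ℝ (Fin 3)) (Subtype.val : (Metric.sphere (0 : EuclideanSpace ℝ (Fin 3)) 1) → EuclideanSpace ℝ (Fin 3)) y :=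
    hval.mdifferentiableAt (by norm_num)
  set L : EuclideanSpace ℝ (Fin 2) →L[ℝ] EuclideanSpace ℝ (Fin 3) :=
    mfderiv (𝓡 2) 𝓘(ℝ, EuclideanSpace ℝ (Fin 3)) (Subtype.val : (Metric.sphere (0 : EuclideanSpace ℝ (Fin 3)) 1) → EuclideanSpace ℝ (Fin 3)) y with hLdef
  set e := chartAt (EuclideanSpace ℝ (Fin 2)) y with he
  set u₀ : EuclideanSpace ℝ (Fin 2) := e.extend (𝓡 2) y with hu₀
  set τ : EuclideanSpace ℝ (Fin 2) → EuclideanSpace ℝ (Fin 3) := Subtype.val ∘ (e.extend (𝓡 2)).symm with hτ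
  have hτu₀ : τ u₀ = y := by
    simp only [hτ, hu₀, Function.comp_apply]
    rw [e.extend_left_inv (I := 𝓡 2) (mem_chart_source _ y)]
  have hτs : ContDiffAt ℝ 2 τ u₀ := ExpHeight.contDiffAt_comp_extend_symm_vec hval
  have hL : ∀ b, L b = fderiv ℝ τ u₀ b := fun b =>
    ExpHeight.mfderiv_eq_fderiv_comp_extend_symm hvald b
  -- the sphere constraint `‖τ‖² = 1`, differentiated twice
  set F : EuclideanSpace ℝ (Fin 3) → ℝ := fun x => ‖x‖ ^ 2 with hF
  have hFτ : F ∘ τ = fun _ => (1 : ℝ) := by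
    funext u
    simp [hF, hτ]
  have hF2 : ∀ x, ContDiffAt ℝ 2 F x := fun x => (contDiff_norm_sq ℝ).contDiffAt
  have hDF : ∀ x : EuclideanSpace ℝ (Fin 3), fderiv ℝ F x = (2 : ℝ) • innerSL ℝ x := fun x => by
    have h : HasFDerivAt F ((2 : ℕ) • innerSL ℝ x) x := (hasStrictFDerivAt_norm_sq x).hasFDerivAt
    rw [h.fderiv, ← Nat.cast_smul_eq_nsmul ℝ]
    norm_num
  have hD2F : ∀ x w w' : EuclideanSpace ℝ (Fin 3), fderiv ℝ (fderiv ℝ F) x w w' = 2 * ⟪w, w'⟫ := by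
    intro x w w'
    have hfun : fderiv ℝ F = fun x => (2 : ℝ) • innerSL ℝ x := funext hDF
    have hlin : HasFDerivAt (fun x : EuclideanSpace ℝ (Fin 3) => (2 : ℝ) • innerSL ℝ x)
        ((2 : ℝ) • (innerSL ℝ : EuclideanSpace ℝ (Fin 3) →L[ℝ] EuclideanSpace ℝ (Fin 3) →L[ℝ] ℝ)) x :=
      ((innerSL ℝ : EuclideanSpace ℝ (Fin 3) →L[ℝ] EuclideanSpace ℝ (Fin 3) →L[ℝ] ℝ).hasFDerivAt).const_smul (2 : ℝ)
    rw [hfun, hlin.fderiv]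
    simp
    rfl
  have hkey : ∀ b b' : EuclideanSpace ℝ (Fin 2), 2 * ⟪fderiv ℝ τ u₀ b, fderiv ℝ τ u₀ b'⟫ +
      2 * ⟪(y : EuclideanSpace ℝ (Fin 3)), fderiv ℝ (fderiv ℝ τ) u₀ b b'⟫ = 0 := by
    intro b b'
    have h1 := ExpHeight.fderiv_fderiv_comp_apply (hF2 (τ u₀)) hτs b b'
    have hz : fderiv ℝ (fderiv ℝ (F ∘ τ)) u₀ b b' = 0 := by
      rw [hFτ]
      simp
    rw [hz, hD2F, hDF, hτu₀] at h1
    simp only [smul_apply, innerSL_apply_apply, smul_eq_mul] at h1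
    linarith
  -- the Hessian of `G|S²` in the preferred chart
  have hGτ : ContDiffAt ℝ 2 G (τ u₀) := by rw [hτu₀]; exact hG
  have hH : mhessian (𝓡 2) (fun z : (Metric.sphere (0 : EuclideanSpace ℝ (Fin 3)) 1) => G z) y a a =
      fderiv ℝ (fderiv ℝ G) y (L a) (L a) - ν * ⟪L a, L a⟫ := by
    rw [← hessianInChart_chartAt, hessianInChart_apply_apply,
      ModelWithCorners.Boundaryless.range_eq_univ, fderivWithin_univ, fderivWithin_univ]
    have hcomp : (fun z : (Metric.sphere (0 : EuclideanSpace ℝ (Fin 3)) 1) => G z) ∘ ((chartAt (EuclideanSpace ℝ (Fin 2)) y).extend (𝓡 2)).symm = G ∘ τ := rfl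
    rw [hcomp, ExpHeight.fderiv_fderiv_comp_apply hGτ hτs, hτu₀, hlag, hL a]
    linear_combination (ν / 2) * hkey a a
  refine ⟨L a, fun h0 => ha ?_, ?_, hH⟩
  · exact mfderiv_coe_sphere_injective (n := 2) y (h0.trans (map_zero L).symm)
  · have hmem : L a ∈ (ℝ ∙ (y : EuclideanSpace ℝ (Fin 3)))ᗮ := by
      rw [← range_mfderiv_coe_sphere (n := 2) y]; exact ⟨a, rfl⟩
    exact Submodule.mem_orthogonal_singleton_iff_inner_right.1 hmem

/-! ### Calculus of the base polynomial `G(q) = q₀ (1 + κ ⟪q, a⟫)` on `ℝ³` -/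

/-- The coordinate `q₀` has differential `pr₀`. [folklore] -/
theorem hasFDerivAt_coord_zero (p : EuclideanSpace ℝ (Fin 3)) :
    HasFDerivAt (fun q : EuclideanSpace ℝ (Fin 3) => q 0) (EuclideanSpace.proj 0 : EuclideanSpace ℝ (Fin 3) →L[ℝ] ℝ) p := by
  have h := (EuclideanSpace.proj (0 : Fin 3) : EuclideanSpace ℝ (Fin 3) →L[ℝ] ℝ).hasFDerivAt (x := p)
  rwa [EuclideanSpace.coe_proj] at h

/-- The affine factor `1 + κ ⟪q, a⟫` has differential `κ ⟪a, ·⟫`. [folklore] -/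
theorem hasFDerivAt_affine (κ : ℝ) (a p : EuclideanSpace ℝ (Fin 3)) :
    HasFDerivAt (fun q : EuclideanSpace ℝ (Fin 3) => 1 + κ * ⟪q, a⟫) (κ • innerSL ℝ a) p := by
  have h1 : HasFDerivAt (fun q : EuclideanSpace ℝ (Fin 3) => ⟪q, a⟫) (innerSL ℝ a) p := by
    refine ((innerSL ℝ a).hasFDerivAt (x := p)).congr_of_eventuallyEq
      (Filter.Eventually.of_forall fun q => ?_)
    simp [real_inner_comm]
  exact (h1.const_mul κ).const_add 1

/-- **First derivative of the base polynomial**: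
`DG(p) = (1 + κ ⟪p, a⟫) pr₀ + κ p₀ ⟪a, ·⟩` (product rule). [folklore] -/
theorem fderiv_basePoly (κ : ℝ) (a : EuclideanSpace ℝ (Fin 3)) :
    fderiv ℝ (fun q : EuclideanSpace ℝ (Fin 3) => q 0 * (1 + κ * ⟪q, a⟫)) = fun p =>
      (1 + κ * ⟪p, a⟫) • (EuclideanSpace.proj 0 : EuclideanSpace ℝ (Fin 3) →L[ℝ] ℝ) + (κ * p 0) • innerSL ℝ a := by
  funext p
  refine (((hasFDerivAt_coord_zero p).mul (hasFDerivAt_affine κ a p)).congr_fderiv ?_).fderiv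
  apply ContinuousLinearMap.ext
  intro w
  simp only [add_apply, smul_apply, smul_eq_mul, PiLp.proj_apply, innerSL_apply_apply]
  ring

/-- **Second derivative of the base polynomial**:
`D²G(p)(w, w') = κ (⟪w, a⟫ w'₀ + w₀ ⟪w', a⟫)` (the derivative of the affine map `DG`).
[folklore] -/
theorem fderiv_fderiv_basePoly_apply (κ : ℝ) (a p w w' : EuclideanSpace ℝ (Fin 3)) :
    fderiv ℝ (fderiv ℝ (fun q : EuclideanSpace ℝ (Fin 3) => q 0 * (1 + κ * ⟪q, a⟫))) p w w' =
      κ * (⟪w, a⟫ * w' 0 + w 0 * ⟪w', a⟫) := by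
  have h : HasFDerivAt (fun q : EuclideanSpace ℝ (Fin 3) =>
      (1 + κ * ⟪q, a⟫) • (EuclideanSpace.proj 0 : EuclideanSpace ℝ (Fin 3) →L[ℝ] ℝ) + (κ * q 0) • innerSL ℝ a)
      ((κ • innerSL ℝ a).smulRight (EuclideanSpace.proj 0 : EuclideanSpace ℝ (Fin 3) →L[ℝ] ℝ) +
        (κ • (EuclideanSpace.proj 0 : EuclideanSpace ℝ (Fin 3) →L[ℝ] ℝ)).smulRight (innerSL ℝ a)) p :=
    ((hasFDerivAt_affine κ a p).smul_const (EuclideanSpace.proj 0 : EuclideanSpace ℝ (Fin 3) →L[ℝ] ℝ)).add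
      (((hasFDerivAt_coord_zero p).const_mul κ).smul_const (innerSL ℝ a))
  rw [fderiv_basePoly, h.fderiv]
  simp only [add_apply, ContinuousLinearMap.smulRight_apply, smul_apply, smul_eq_mul,
    PiLp.proj_apply, innerSL_apply_apply]
  rw [real_inner_comm a w, real_inner_comm a w']
  ring

/-- The base polynomial is smooth. [folklore] -/
theorem contDiff_basePoly (κ : ℝ) (a : EuclideanSpace ℝ (Fin 3)) :
    ContDiff ℝ ∞ (fun q : EuclideanSpace ℝ (Fin 3) => q 0 * (1 + κ * ⟪q, a⟫)) := by
  have h0 : ContDiff ℝ ∞ (fun q : EuclideanSpace ℝ (Fin 3) => q 0) :=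
    (EuclideanSpace.proj (0 : Fin 3) : EuclideanSpace ℝ (Fin 3) →L[ℝ] ℝ).contDiff
  have h1 : ContDiff ℝ ∞ (fun q : EuclideanSpace ℝ (Fin 3) => ⟪q, a⟫) :=
    ContDiff.inner (𝕜 := ℝ) contDiff_id contDiff_const
  exact h0.mul (contDiff_const.add (contDiff_const.mul h1))

/-- Membership in the unit sphere of `ℝ³` in coordinates. [folklore] -/
theorem mem_sphere_iff_coord (y : EuclideanSpace ℝ (Fin 3)) : y ∈ (Metric.sphere (0 : EuclideanSpace ℝ (Fin 3)) 1) ↔ y 0 ^ 2 + y 1 ^ 2 + y 2 ^ 2 = 1 := by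
  rw [mem_sphere_zero_iff_norm, ← sq_eq_sq₀ (norm_nonneg _) zero_le_one, one_pow,
    EuclideanSpace.real_norm_sq_eq, Fin.sum_univ_three]

/-! ### The base polynomial against a pole `v = (0, 0, ±1)`, `κ = -1/4` -/

/-- For `v ∈ S²` with `v₀ = v₁ = 0`: `v₂² = 1`. [folklore] -/
theorem pole_sq (v : (Metric.sphere (0 : EuclideanSpace ℝ (Fin 3)) 1)) (hv0 : (v : EuclideanSpace ℝ (Fin 3)) 0 = 0) (hv1 : (v : EuclideanSpace ℝ (Fin 3)) 1 = 0) :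
    (v : EuclideanSpace ℝ (Fin 3)) 2 ^ 2 = 1 := by
  have h := (mem_sphere_iff_coord (v : EuclideanSpace ℝ (Fin 3))).1 v.2
  rw [hv0, hv1] at h
  linear_combination h

/-- For `v ∈ S²` with `v₀ = v₁ = 0`: `⟪q, v⟫ = q₂ v₂`. [folklore] -/
theorem inner_pole (v : (Metric.sphere (0 : EuclideanSpace ℝ (Fin 3)) 1)) (hv0 : (v : EuclideanSpace ℝ (Fin 3)) 0 = 0) (hv1 : (v : EuclideanSpace ℝ (Fin 3)) 1 = 0) (q : EuclideanSpace ℝ (Fin 3)) :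
    ⟪q, (v : EuclideanSpace ℝ (Fin 3))⟫ = q 2 * (v : EuclideanSpace ℝ (Fin 3)) 2 := by
  rw [BandFoliation.inner_eq_three, hv0, hv1]; ring

/-- The differential of `G(q) = q₀ (1 - ⟪q, v⟫/4)` in coordinates:
`DG(y) w = (1 - y₂ v₂/4) w₀ - y₀ v₂ w₂/4`. [folklore] -/
theorem fderiv_base_apply (v : (Metric.sphere (0 : EuclideanSpace ℝ (Fin 3)) 1)) (hv0 : (v : EuclideanSpace ℝ (Fin 3)) 0 = 0) (hv1 : (v : EuclideanSpace ℝ (Fin 3)) 1 = 0) (y w : EuclideanSpace ℝ (Fin 3)) :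
    fderiv ℝ (fun q : EuclideanSpace ℝ (Fin 3) => q 0 * (1 + (-(1 / 4 : ℝ)) * ⟪q, (v : EuclideanSpace ℝ (Fin 3))⟫)) y w =
      (1 + (-(1 / 4 : ℝ)) * (y 2 * (v : EuclideanSpace ℝ (Fin 3)) 2)) * w 0 +
        (-(1 / 4 : ℝ)) * y 0 * (v : EuclideanSpace ℝ (Fin 3)) 2 * w 2 := by
  rw [fderiv_basePoly]
  simp only [add_apply, smul_apply, smul_eq_mul, PiLp.proj_apply, innerSL_apply_apply]
  rw [inner_pole v hv0 hv1, BandFoliation.inner_eq_three, hv0, hv1]; ring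

/-- The second differential of `G` on the diagonal: `D²G(y)(w, w) = -v₂ w₀ w₂/2`. [folklore] -/
theorem fderiv_fderiv_base_apply (v : (Metric.sphere (0 : EuclideanSpace ℝ (Fin 3)) 1)) (hv0 : (v : EuclideanSpace ℝ (Fin 3)) 0 = 0) (hv1 : (v : EuclideanSpace ℝ (Fin 3)) 1 = 0)
    (y w : EuclideanSpace ℝ (Fin 3)) :
    fderiv ℝ (fderiv ℝ (fun q : EuclideanSpace ℝ (Fin 3) => q 0 * (1 + (-(1 / 4 : ℝ)) * ⟪q, (v : EuclideanSpace ℝ (Fin 3))⟫))) y w w =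
      2 * (-(1 / 4 : ℝ)) * (v : EuclideanSpace ℝ (Fin 3)) 2 * w 0 * w 2 := by
  rw [fderiv_fderiv_basePoly_apply, inner_pole v hv0 hv1]; ring

/-- **Lagrange's condition in coordinates.**  `y ∈ S²` is a critical point of the base
function `ℓ = G|S²` iff the gradient `∇G(y) = (1 - y₂v₂/4, 0, -y₀v₂/4)` is a multiple `ν y`
of `y`. [cite: Milnor1963, §2] -/
theorem isMCriticalPt_base_iff (v : (Metric.sphere (0 : EuclideanSpace ℝ (Fin 3)) 1)) (hv0 : (v : EuclideanSpace ℝ (Fin 3)) 0 = 0) (hv1 : (v : EuclideanSpace ℝ (Fin 3)) 1 = 0)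
    (ℓ : (Metric.sphere (0 : EuclideanSpace ℝ (Fin 3)) 1) → ℝ)
    (hℓ : ℓ = (fun y : (Metric.sphere (0 : EuclideanSpace ℝ (Fin 3)) 1) => (y : EuclideanSpace ℝ (Fin 3)) 0 * (1 + (-(1 / 4 : ℝ)) * ⟪(y : EuclideanSpace ℝ (Fin 3)), (v : EuclideanSpace ℝ (Fin 3))⟫)))
    (y : (Metric.sphere (0 : EuclideanSpace ℝ (Fin 3)) 1)) :
    IsMCriticalPt (𝓡 2) ℓ y ↔ ∃ ν : ℝ,
      1 + (-(1 / 4 : ℝ)) * ((y : EuclideanSpace ℝ (Fin 3)) 2 * (v : EuclideanSpace ℝ (Fin 3)) 2) = ν * (y : EuclideanSpace ℝ (Fin 3)) 0 ∧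
      (0 : ℝ) = ν * (y : EuclideanSpace ℝ (Fin 3)) 1 ∧
      (-(1 / 4 : ℝ)) * (y : EuclideanSpace ℝ (Fin 3)) 0 * (v : EuclideanSpace ℝ (Fin 3)) 2 = ν * (y : EuclideanSpace ℝ (Fin 3)) 2 := by
  set G : EuclideanSpace ℝ (Fin 3) → ℝ := fun q => q 0 * (1 + (-(1 / 4 : ℝ)) * ⟪q, (v : EuclideanSpace ℝ (Fin 3))⟫) with hGdef
  have hℓG : ℓ = fun z : (Metric.sphere (0 : EuclideanSpace ℝ (Fin 3)) 1) => G z := hℓ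
  have hGd : DifferentiableAt ℝ G y :=
    ((contDiff_basePoly (-(1 / 4 : ℝ)) (v : EuclideanSpace ℝ (Fin 3))).differentiable (by simp)).differentiableAt
  rw [hℓG, isMCriticalPt_sphere_iff (G := G) y hGd]
  -- the gradient vector
  set g : EuclideanSpace ℝ (Fin 3) := WithLp.toLp 2 ![1 + (-(1 / 4 : ℝ)) * ((y : EuclideanSpace ℝ (Fin 3)) 2 * (v : EuclideanSpace ℝ (Fin 3)) 2), 0,
    (-(1 / 4 : ℝ)) * (y : EuclideanSpace ℝ (Fin 3)) 0 * (v : EuclideanSpace ℝ (Fin 3)) 2] with hg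
  have hgw : ∀ w, fderiv ℝ G y w = ⟪g, w⟫ := fun w => by
    rw [hGdef, fderiv_base_apply v hv0 hv1, BandFoliation.inner_eq_three]
    simp [hg]
  simp only [hgw]
  rw [forall_inner_eq_zero_iff _ _ (norm_eq_of_mem_sphere y)]
  refine exists_congr fun ν => ⟨fun h => ?_, fun h => ?_⟩
  · have hc : ∀ i, g i = ν * (y : EuclideanSpace ℝ (Fin 3)) i := fun i => by
      have := congrArg (fun z : EuclideanSpace ℝ (Fin 3) => z i) h
      simpa using this
    exact ⟨by simpa [hg] using hc 0, by simpa [hg] using hc 1, by simpa [hg] using hc 2⟩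
  · obtain ⟨h0, h1, h2⟩ := h
    ext i
    fin_cases i
    · simpa [hg] using h0
    · simpa [hg] using h1
    · simpa [hg] using h2

/-- **Helper `helper_basePoint` — the two critical points `(ε r, 0, s v₂)`, `ε = ±1`.**  With
`s` the root of `s² - 2s - 1/2` in `[-1, 0)` (`s = 1 - √(3/2)`) and `r = √(1 - s²)`: each is
a critical point of the base function `ℓ` (Lagrange multiplier `ν = ε r (1 - s/2)`); the
Hessian of `ℓ` there is `ε`-definite — `ε · Hess ℓ (a, a) < 0` for `a ≠ 0`, since on the
tangent plane `ε r w₀ + s v₂ w₂ = 0` it reads `-v₂ w₀ w₂/2 - ν ‖w‖²` (Milnor 1963, §2); and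
`ℓ = ε r (1 - s/4)` there. [cite: Milnor1963, §2] -/
theorem helper_basePoint : ∀ (v : Metric.sphere (0 : EuclideanSpace ℝ (Fin 3)) 1), (v : EuclideanSpace ℝ (Fin 3)) 0 = 0 → (v : EuclideanSpace ℝ (Fin 3)) 1 = 0 → ∀ ℓ : Metric.sphere (0 : EuclideanSpace ℝ (Fin 3)) 1 → ℝ, ℓ = (fun y : Metric.sphere (0 : EuclideanSpace ℝ (Fin 3)) 1 => (y : EuclideanSpace ℝ (Fin 3)) 0 * (1 + (-(1 / 4 : ℝ)) * ⟪(y : EuclideanSpace ℝ (Fin 3)), (v : EuclideanSpace ℝ (Fin 3))⟫)) → ∀ s r ε : ℝ, s ^ 2 - 2 * s - 1 / 2 = 0 → s < 0 → r ^ 2 = 1 - s ^ 2 → 0 < r → ε ^ 2 = 1 → ∀ y : Metric.sphere (0 : EuclideanSpace ℝ (Fin 3)) 1, (y : EuclideanSpace ℝ (Fin 3)) 0 = ε * r → (y : EuclideanSpace ℝ (Fin 3)) 1 = 0 → (y : EuclideanSpace ℝ (Fin 3)) 2 = s * (v : EuclideanSpace ℝ (Fin 3)) 2 → IsMCriticalPt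 (𝓡 2) ℓ y ∧ (∀ a : EuclideanSpace ℝ (Fin 2), a ≠ 0 → ε * mhessian (𝓡 2) ℓ y a a < 0) ∧ ℓ y = ε * (r * (1 + (-(1 / 4 : ℝ)) * s)) := by
  intro v hv0 hv1 ℓ hℓ s r ε hs hs0 hr hr0 hε y hy0 hy1 hy2
  have hV := pole_sq v hv0 hv1
  set v₂ : ℝ := (v : EuclideanSpace ℝ (Fin 3)) 2 with hv₂
  -- the Lagrange multiplier
  set ν : ℝ := ε * r * (1 - s / 2) with hν
  have e0 : 1 + (-(1 / 4 : ℝ)) * (s * v₂ * v₂) = ν * (ε * r) := by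
    linear_combination (-(s / 2)) * hs - (s / 4) * hV - (1 - s / 2) * r ^ 2 * hε -
      (1 - s / 2) * hr
  have e2 : (-(1 / 4 : ℝ)) * (ε * r) * v₂ = ν * (s * v₂) := by
    linear_combination ((1 / 2) * ε * r * v₂) * hs
  refine ⟨?_, ?_, ?_⟩
  · rw [isMCriticalPt_base_iff v hv0 hv1 ℓ hℓ y]
    refine ⟨ν, ?_, ?_, ?_⟩
    · rw [hy0, hy2]; exact e0
    · rw [hy1, mul_zero]
    · rw [hy0, hy2]; exact e2
  · intro a ha
    set G : EuclideanSpace ℝ (Fin 3) → ℝ := fun q => q 0 * (1 + (-(1 / 4 : ℝ)) * ⟪q, (v : EuclideanSpace ℝ (Fin 3))⟫) with hGdef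
    have hℓG : ℓ = fun z : (Metric.sphere (0 : EuclideanSpace ℝ (Fin 3)) 1) => G z := hℓ
    have hG2 : ContDiffAt ℝ 2 G y :=
      ((contDiff_basePoly (-(1 / 4 : ℝ)) (v : EuclideanSpace ℝ (Fin 3))).of_le (by norm_cast)).contDiffAt
    have hlag : ∀ w : EuclideanSpace ℝ (Fin 3), fderiv ℝ G y w = ν * ⟪(y : EuclideanSpace ℝ (Fin 3)), w⟫ := fun w => by
      rw [hGdef, fderiv_base_apply v hv0 hv1, BandFoliation.inner_eq_three, hy0, hy1, hy2]
      linear_combination (w 0) * e0 + (w 2) * e2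
    obtain ⟨w, hw0, hyw, hH⟩ := mhessian_sphere_apply_self (G := G) y hG2 hlag ha
    rw [hℓG, hH, hGdef, fderiv_fderiv_base_apply v hv0 hv1, BandFoliation.inner_eq_three]
    rw [BandFoliation.inner_eq_three, hy0, hy1, hy2] at hyw
    have hN : 0 < w 0 * w 0 + w 1 * w 1 + w 2 * w 2 := by
      have h1 : ⟪w, w⟫ ≠ 0 := fun h => hw0 (inner_self_eq_zero.1 h)
      have h2 : 0 ≤ ⟪w, w⟫ := real_inner_self_nonneg
      rw [BandFoliation.inner_eq_three] at h1 h2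
      exact lt_of_le_of_ne h2 (Ne.symm h1)
    have hX : 0 ≤ ε * v₂ * w 0 * w 2 := by
      have hC : r * (w 0 * w 0) + s * (ε * v₂ * w 0 * w 2) = 0 := by
        linear_combination ε * (w 0) * hyw - r * (w 0) ^ 2 * hε
      nlinarith [hC, hs0, hr0, mul_self_nonneg (w 0)]
    have hcoef : 0 < r * (1 - s / 2) := by nlinarith
    have hRN := mul_pos hcoef hN
    have key : ε * (2 * (-(1 / 4 : ℝ)) * v₂ * w 0 * w 2 -
        ν * (w 0 * w 0 + w 1 * w 1 + w 2 * w 2)) =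
        -(1 / 2) * (ε * v₂ * w 0 * w 2) -
          r * (1 - s / 2) * (w 0 * w 0 + w 1 * w 1 + w 2 * w 2) := by
      linear_combination (-(r * (1 - s / 2) * (w 0 * w 0 + w 1 * w 1 + w 2 * w 2))) * hε
    rw [key]
    nlinarith [hX, hRN]
  · rw [hℓ]
    simp only
    rw [inner_pole v hv0 hv1, hy0, hy2]
    linear_combination (-(1 / 4 : ℝ)) * ε * r * s * hV

end Summit.SmoothPoincare4.SmoothPoincare4.Cruxes.RungOne.Sketch

end
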